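import Summits.QuantumFields.BalabanUV.T4Continuum.Support.CTConjugationPieces
import Summits.QuantumFields.BalabanUV.T4Continuum.Support.BlockSumDecay

/-!
# T⁴ programme, spine node NE2 (U1a), sub-row Δ3 «NE2-WALK» (T4-DAG `T4-U1a.S-NE2-D3-WALK°`) — THE COMBES–THOMAS DICTIONARY
# FOR AVERAGED TOWERS: the entries of the unit-lattice images `avgTow A r X k` are BLOCK PAIRINGS of `X_k`, so a level-uniform bound
# on the CONJUGATED kernels `e^{κρ}X_ke^{−κρ}` (centre-indexed fine-scale weights `ρ`) IS the uniform entry decay `hdec`; and the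
# conjugated perturbed inverse `(D + tP)⁻¹` is controlled by weighted coercivity of `D` plus a conjugated relative bound on `P`

NE2 formalisation swarm `b2b-balaban-t4-ne2-formalise-*`, leaf prover 06 (gen 3), supplier item «Δ3-CT» under the row owner's sub-row
Δ3 (INTENT CLAIMS.log l.14496), file A (generic; file B `Support/CTKingTowerWeights` = King's tower, the canonical weights and the ENDs on
`pertCovC`).  Companion of the owner's `Support/BlockSumDecay` (p219633) and `Support/DecayRateInterpolation` / `Spine/NE2BalabanDecayRate`
(p218010 / p218845): those convert the landed operator-norm rate of tier B into King's (4.38) decay shape MODULO one displayed binder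
`hdec : ∀ k, EntryDecay dist (c_k) B δ` on the unit-lattice images `c_k = r^k·A^{(k)}X_kA^{(k)ᴴ}`, and re-type `hdec` on the FINE kernel in
block-ℓ¹ currency (`BlockL1Decay`, referee c14).  THIS FILE gives the ℓ²/OPERATOR twin of that re-typing — the Combes–Thomas currency
of the substrate cell's `CTWeightedCoercivity` (p219020) / `CTConjugationPieces` (p219511):

 * §1 CONJUGATED OPERATOR BOUNDS (any finite index type): **`pairing_le_of_opNorm_conjMat`** — `‖conjMat κ ρ ρ X‖ ≤ K`, `u` supported
   in `{ρ ≥ R}`, `v` in `{ρ ≤ 0}`, `κ ≥ 0` ⟹ `|⟨u, Xv⟩| ≤ K·e^{−κR}·‖u‖‖v‖`; **`coercive_conjMat_of_wCoercive`** — `WCoercive D κ ρ γw` IS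
   `Coercive γw (conjMat κ ρ ρ D)` (by `conjForm_eq`), hence **`opNorm_conjMat_inv_le_of_wCoercive`** `‖conjMat κ ρ ρ D⁻¹‖ ≤ γw⁻¹`;
   **`opNorm_conjMat_inv_add_smul_le`** — with a CONJUGATED RELATIVE BOUND `‖conjMat P · conjMat D⁻¹‖ ≤ κ′` and `‖t‖κ′ < 1`:
   `‖conjMat ((D + t•P)⁻¹)‖ ≤ ‖conjMat D⁻¹‖·(1 − ‖t‖κ′)⁻¹` (`BackgroundResolventLaw.opNorm_inv_add_smul_le` run on the conjugated pair —
   `conjMat` is multiplicative and commutes with inversion); **`opNorm_conjMat_pertInv_le_of_wCoercive`** (the two combined).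
 * §2 THE BLOCK PAIRING (any index tower `ι`, any one-step averagings `A_k`): **`avgTow_apply_eq_pairing`** —
   `(avgTow A r X k)(x,y) = r^k·⟨a_x, X_k a_y⟩` with the block test vectors `a_x = star (Atow A k x ·)`, `nsq a_x ≤ ‖Atow A k‖² ≤ r^{−k}`
   (`nsq_star_Atow_le`); under BlockSumDecay's INDICATOR STRUCTURE `A k i u = r⁻¹·[prt k u = i]`, `a_x` is supported in the unit block
   `{u : prtk u = x}` (`star_Atow_apply_ne_zero`).
 * §3 **`entryDecay_avgTow_of_conjInv`** — THE DICTIONARY: centre-indexed weights `ρ : ι 0 → ι k → ℝ` with `ρ_y ≤ 0` on the block of `y`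
   and `ρ_y ≥ dist(x,y) − c` on the block of `x`, and `‖conjMat κ (ρ y) (ρ y) (X k)‖ ≤ K` for every centre `y`
   ⟹ `EntryDecay dist (avgTow A r X k) (K·e^{κc}) κ` (the factor `r^k` of `avgTow` against `‖a_x‖‖a_y‖ ≤ r^{−k}`: no loss).
 * §4 THE COLOUR LIFT: `conjMat` of `X ⊗ₖ 1` with weights read through `Prod.fst` is `conjMat X ⊗ₖ 1` (`conjMat_kron_one`); hence the
   §1 bounds for `D ⊗ₖ 1` and `D ⊗ₖ 1 + t•P` from the UN-LIFTED weighted coercivity of `D` (`opNorm_conjMat_kron_inv_le_of_wCoercive`,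
   `opNorm_conjMat_kron_pertInv_le_of_wCoercive`) — the form in which file B consumes a `U = 1` input stated on `Tor (fine n M) × Fin d`.

WHAT THE TWO DISPLAYED INPUTS ARE (honest).  (i) `WCoercive D κ ρ γw` for the free operator at fine-scale Lipschitz weights — at `U = 1`
for Bałaban's `Δ_a` this is the Combes–Thomas core the β-cell's `Literature/…/Beta/DeltaACombesThomas` proves MODULO the row defect of the
non-local `∂P∂*` piece and the substrate programme VEC (`CTWeightedCoercivity` ff.) is assembling in full; asserted by nobody here.
(ii) the CONJUGATED relative bound `‖conjMat P · conjMat D⁻¹‖ ≤ κ′` — the weighted twin of tier B's (H-bd) `‖P D⁻¹‖ ≤ κ`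
(`BackgroundResolventTower.PerturbationLaws`); for first-order pieces `M·∇` it is a weighted Gram bound (`WCoercive.gram_bound`), for
bounded pieces a conjugation-defect bound — dischargeable summand by summand, NOT discharged here.

HONEST FRAMING (T4-DAG p. 1).  [folklore] finite-dimensional linear algebra (Combes–Thomas 1973 / Agmon conjugation, resolvent identity,
Cauchy–Schwarz); statements OURS; nothing printed is a hypothesis or a conclusion; no `def`; no NE row is estimated; `hdec` is NOT
discharged by this file (it is RE-TYPED); sub-row Δ3 NOT closed; NE2 (U1a) NOT PROVED; spine PROVED 0/9 unchanged; NOT infinite volume,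
NOT a mass gap, NOT the Clay problem, NOT summit progress.  HONEST DEPENDENCY: continuum YM on T⁴ ⇐ BetaPertH ∧ nine spine estimates
(0/9 proved); BetaPertH ⇐ (D1) ∧ (D4) ∧ CAP+tail; G-an2-4 gates asym, D1 and NE2/3/4.  ABSOLUTE RULE kept; no `sorry`.
-/

noncomputable section

open scoped BigOperators ComplexConjugate Matrix Matrix.Norms.L2Operator Kronecker

namespace Summit.QuantumFields.BalabanUV.T4Continuum.CTAveragedTowerDecay

open Literature.MathematicalPhysics.QuantumFieldTheory.Balaban1983to89.B5Prop11Lower (nsq nsq_nonneg norm_star_dotProduct_le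
  norm_form_le)
open Summit.QuantumFields.BalabanUV.T4Continuum
open Summit.QuantumFields.BalabanUV.T4Continuum.CoerciveInverseTower (Coercive isUnit_of_coercive opNorm_inv_le_of_coercive)
open Summit.QuantumFields.BalabanUV.T4Continuum.CovariantAveragingTower (Atow Atow_zero Atow_succ avgTow opNorm_Atow_sq_le)
open Summit.QuantumFields.BalabanUV.T4Continuum.ScalarCovariantCTWeighted (wvec wvec_wvec_neg dotProduct_wvec nsq_wvec_le_of_nonpos
  sqrt_nsq_wvec_neg_le)
open Summit.QuantumFields.BalabanUV.T4Continuum.CTWeightedCoercivity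
open Summit.QuantumFields.BalabanUV.T4Continuum.CTConjugationPieces (conjMat_inv)
open Summit.QuantumFields.BalabanUV.T4Continuum.BackgroundResolventLaw (opNorm_inv_add_smul_le)
open Summit.QuantumFields.BalabanUV.T4Continuum.BlockSumDecay (prtk Atow_apply_of_indicator)
open Summit.QuantumFields.BalabanUV.T4Continuum.DecayRateInterpolation (EntryDecay)
open Summit.QuantumFields.BalabanUV.T4Continuum.GaugeTermCoercivity (nsq_mulVec_le_rect)
open Summit.QuantumFields.BalabanUV.T4Continuum.KroneckerLift (kron_inv opNorm_kron_le isUnit_det_kron)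

/-! ## §1 Conjugated operator bounds: pairing decay, the inverse under weighted coercivity, the perturbed inverse -/

section Conj

variable {ι : Type*} [Fintype ι] [DecidableEq ι]

/-- **PAIRING DECAY FROM A CONJUGATED OPERATOR BOUND**: if `‖e^{κρ}Xe^{−κρ}‖ ≤ K`, `κ ≥ 0`, `u` is supported in `{ρ ≥ R}` and `v` in
`{ρ ≤ 0}`, then `|⟨u, Xv⟩| ≤ K·e^{−κR}·‖u‖‖v‖` (`⟨u, Xv⟩ = ⟨e^{−κρ}u, (e^{κρ}Xe^{−κρ})(e^{κρ}v)⟩`). [folklore] -/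
theorem pairing_le_of_opNorm_conjMat {X : Matrix ι ι ℂ} {κ : ℝ} (hκ : 0 ≤ κ) {ρ : ι → ℝ} {K R : ℝ} (hK : ‖conjMat κ ρ ρ X‖ ≤ K)
    {u v : ι → ℂ} (hu : ∀ e, u e ≠ 0 → R ≤ ρ e) (hv : ∀ e, v e ≠ 0 → ρ e ≤ 0) :
    ‖star u ⬝ᵥ (X *ᵥ v)‖ ≤ K * Real.exp (-(κ * R)) * (Real.sqrt (nsq u) * Real.sqrt (nsq v)) := by
  have e : star u ⬝ᵥ (X *ᵥ v) = star (wvec (-κ) ρ u) ⬝ᵥ (conjMat κ ρ ρ X *ᵥ wvec κ ρ v) := by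
    rw [dotProduct_wvec κ ρ u (X *ᵥ v), wvec_mulVec]
  rw [e]
  have h1 := norm_form_le (conjMat κ ρ ρ X) (wvec (-κ) ρ u) (wvec κ ρ v)
  have hu' := sqrt_nsq_wvec_neg_le hκ hu
  have hv' : Real.sqrt (nsq (wvec κ ρ v)) ≤ Real.sqrt (nsq v) := Real.sqrt_le_sqrt (nsq_wvec_le_of_nonpos hκ hv)
  have hK0 : 0 ≤ K := (norm_nonneg _).trans hK
  calc ‖star (wvec (-κ) ρ u) ⬝ᵥ (conjMat κ ρ ρ X *ᵥ wvec κ ρ v)‖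
      ≤ ‖conjMat κ ρ ρ X‖ * (Real.sqrt (nsq (wvec (-κ) ρ u)) * Real.sqrt (nsq (wvec κ ρ v))) := h1
    _ ≤ K * ((Real.exp (-(κ * R)) * Real.sqrt (nsq u)) * Real.sqrt (nsq v)) :=
        mul_le_mul hK (mul_le_mul hu' hv' (Real.sqrt_nonneg _) (by positivity)) (by positivity) hK0
    _ = K * Real.exp (-(κ * R)) * (Real.sqrt (nsq u) * Real.sqrt (nsq v)) := by ring

variable {D : Matrix ι ι ℂ} {κ : ℝ} {ρ : ι → ℝ} {γw : ℝ}

omit [DecidableEq ι] in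
/-- **WEIGHTED COERCIVITY IS COERCIVITY OF THE CONJUGATED KERNEL**: `WCoercive D κ ρ γw ⟹ Coercive γw (conjMat κ ρ ρ D)`. [folklore] -/
theorem coercive_conjMat_of_wCoercive (h : WCoercive D κ ρ γw) : Coercive γw (conjMat κ ρ ρ D) := fun z => by
  have hz := h z
  rwa [conjForm_eq] at hz

omit [DecidableEq ι] in
/-- **at rate `κ = 0` weighted coercivity IS coercivity** (the conjugation is the identity, `conjMat_zero`): the non-vacuity face of the
displayed `U = 1` input. [folklore] -/
theorem wCoercive_zero_of_coercive {γ : ℝ} (h : Coercive γ D) (ρ : ι → ℝ) : WCoercive D 0 ρ γ := fun z => by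
  rw [conjForm_eq, conjMat_zero]
  exact h z

/-- hence the conjugated kernel has invertible determinant (`γw > 0`). [folklore] -/
theorem isUnit_det_conjMat_of_wCoercive (h : WCoercive D κ ρ γw) (hγ : 0 < γw) : IsUnit (conjMat κ ρ ρ D).det :=
  (Matrix.isUnit_iff_isUnit_det _).mp (isUnit_of_coercive hγ (coercive_conjMat_of_wCoercive h))

/-- **THE CONJUGATED INVERSE**: `WCoercive D κ ρ γw`, `γw > 0` ⟹ `‖e^{κρ}D⁻¹e^{−κρ}‖ ≤ γw⁻¹`. [folklore] -/
theorem opNorm_conjMat_inv_le_of_wCoercive (h : WCoercive D κ ρ γw) (hγ : 0 < γw) : ‖conjMat κ ρ ρ D⁻¹‖ ≤ γw⁻¹ := by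
  rw [conjMat_inv]
  exact opNorm_inv_le_of_coercive hγ (coercive_conjMat_of_wCoercive h)

omit [DecidableEq ι] in
/-- the product rule of `conjMat` at equal weights. [folklore] -/
theorem conjMat_mul_same (κ : ℝ) (ρ : ι → ℝ) (X Y : Matrix ι ι ℂ) :
    conjMat κ ρ ρ (X * Y) = conjMat κ ρ ρ X * conjMat κ ρ ρ Y :=
  conjMat_mul κ ρ ρ ρ X Y

/-- **THE CONJUGATED PERTURBED INVERSE**: with `e^{κρ}De^{−κρ}` invertible, `‖conjMat D⁻¹‖ ≤ G`, the CONJUGATED RELATIVE BOUND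
`‖conjMat P · conjMat D⁻¹‖ ≤ κ′` and `‖t‖κ′ < 1`: `‖conjMat ((D + t•P)⁻¹)‖ ≤ G·(1 − ‖t‖κ′)⁻¹` — the Neumann bound of
`BackgroundResolventLaw` on the conjugated pair. [folklore] -/
theorem opNorm_conjMat_inv_add_smul_le {P : Matrix ι ι ℂ} {G κ' : ℝ} (hD : IsUnit (conjMat κ ρ ρ D).det)
    (hG : ‖conjMat κ ρ ρ D⁻¹‖ ≤ G) (hP : ‖conjMat κ ρ ρ P * conjMat κ ρ ρ D⁻¹‖ ≤ κ') {t : ℂ} (ht : ‖t‖ * κ' < 1) :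
    ‖conjMat κ ρ ρ (D + t • P)⁻¹‖ ≤ G * (1 - ‖t‖ * κ')⁻¹ := by
  rw [conjMat_inv, conjMat_add, conjMat_smul]
  rw [conjMat_inv] at hG hP
  have h := opNorm_inv_add_smul_le hD hP ht
  exact h.trans (mul_le_mul_of_nonneg_right hG (inv_nonneg.mpr (sub_pos.mpr ht).le))

/-- **the two combined**: `WCoercive D κ ρ γw`, `γw > 0`, `‖conjMat P · conjMat D⁻¹‖ ≤ κ′`, `‖t‖κ′ < 1` ⟹
`‖conjMat ((D + t•P)⁻¹)‖ ≤ γw⁻¹·(1 − ‖t‖κ′)⁻¹`. [folklore] -/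
theorem opNorm_conjMat_pertInv_le_of_wCoercive {P : Matrix ι ι ℂ} {κ' : ℝ} (h : WCoercive D κ ρ γw) (hγ : 0 < γw)
    (hP : ‖conjMat κ ρ ρ P * conjMat κ ρ ρ D⁻¹‖ ≤ κ') {t : ℂ} (ht : ‖t‖ * κ' < 1) :
    ‖conjMat κ ρ ρ (D + t • P)⁻¹‖ ≤ γw⁻¹ * (1 - ‖t‖ * κ')⁻¹ :=
  opNorm_conjMat_inv_add_smul_le (isUnit_det_conjMat_of_wCoercive h hγ) (opNorm_conjMat_inv_le_of_wCoercive h hγ) hP ht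

end Conj

/-! ## §2 The entries of the unit-lattice image are block pairings -/

section Tower

variable {ι : ℕ → Type*} [∀ k, Fintype (ι k)] [∀ k, DecidableEq (ι k)]

/-- **THE BLOCK PAIRING**: `(avgTow A r X k)(x,y) = r^k·⟨a_x, X_k a_y⟩` with `a_x = star (Atow A k x ·)` (the conjugate of row `x` of the
composite averaging). [folklore] -/
theorem avgTow_apply_eq_pairing (A : (k : ℕ) → Matrix (ι k) (ι (k + 1)) ℂ) (r : ℝ) (X : (k : ℕ) → Matrix (ι k) (ι k) ℂ) (k : ℕ)
    (x y : ι 0) :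
    avgTow A r X k x y = ((r : ℂ)) ^ k * (star (star (Atow A k x)) ⬝ᵥ (X k *ᵥ star (Atow A k y))) := by
  rw [star_star, avgTow, Matrix.smul_apply, smul_eq_mul, Matrix.mul_assoc, Matrix.mul_apply]
  rfl

/-- `star` of a vector has the vector's `nsq`. [folklore] -/
theorem nsq_star {m : Type*} [Fintype m] (v : m → ℂ) : nsq (star v) = nsq v := by
  unfold nsq
  exact Finset.sum_congr rfl fun u _ => by rw [Pi.star_apply, norm_star]

/-- a row of a matrix is bounded by its operator norm: `nsq (M x ·) ≤ ‖M‖²` (the row is `Mᴴ` applied to a basis vector). [folklore] -/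
theorem nsq_row_le {m n : Type*} [Fintype m] [DecidableEq m] [Fintype n] [DecidableEq n] (M : Matrix m n ℂ) (x : m) :
    nsq (fun u => M x u) ≤ ‖M‖ ^ 2 := by
  have e : (fun u => M x u) = star (Mᴴ *ᵥ Pi.single x 1) := by
    funext u
    rw [Pi.star_apply, Matrix.mulVec, dotProduct, Finset.sum_eq_single x]
    · rw [Matrix.conjTranspose_apply, Pi.single_eq_same, mul_one, star_star]
    · intro b _ hb; rw [Pi.single_eq_of_ne hb, mul_zero]
    · intro h; exact absurd (Finset.mem_univ x) h
  have h1 : nsq (Pi.single x (1 : ℂ) : m → ℂ) = 1 := by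
    unfold nsq
    rw [Finset.sum_eq_single x]
    · rw [Pi.single_eq_same, norm_one, one_pow]
    · intro b _ hb; rw [Pi.single_eq_of_ne hb, norm_zero]; ring
    · intro h; exact absurd (Finset.mem_univ x) h
  rw [e, nsq_star]
  calc nsq (Mᴴ *ᵥ Pi.single x 1) ≤ ‖Mᴴ‖ ^ 2 * nsq (Pi.single x (1 : ℂ) : m → ℂ) := nsq_mulVec_le_rect _ _
    _ = ‖M‖ ^ 2 := by rw [Matrix.l2_opNorm_conjTranspose, h1, mul_one]

/-- **the block test vectors are small**: `nsq (star (Atow A k x ·)) ≤ ‖Atow A k‖² ≤ r^{−k}` (`‖A_j‖² ≤ r⁻¹`). [folklore] -/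
theorem nsq_star_Atow_le (A : (k : ℕ) → Matrix (ι k) (ι (k + 1)) ℂ) {r : ℝ} (hr : 0 < r) (hA : ∀ k, ‖A k‖ ^ 2 ≤ r⁻¹)
    (k : ℕ) (x : ι 0) : nsq (star (Atow A k x)) ≤ (r ^ k)⁻¹ := by
  rw [nsq_star]
  exact (nsq_row_le (Atow A k) x).trans (opNorm_Atow_sq_le A hr hA k)

variable {A : (k : ℕ) → Matrix (ι k) (ι (k + 1)) ℂ} {prt : (k : ℕ) → ι (k + 1) → ι k} {r : ℝ}

/-- **under indicator structure the block test vector of `x` lives in the block of `x`**: `star (Atow A k x u) ≠ 0 ⟹ prtk u = x`.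
[folklore] -/
theorem star_Atow_apply_ne_zero (hA : ∀ k i u, A k i u = if prt k u = i then ((r : ℂ))⁻¹ else 0) {k : ℕ} {x : ι 0} {u : ι k}
    (h : star (Atow A k x) u ≠ 0) : prtk prt k u = x := by
  rw [Pi.star_apply, Atow_apply_of_indicator hA k x u] at h
  by_contra hne
  rw [if_neg hne, star_zero] at h
  exact h rfl

/-! ## §3 The dictionary: a centre-uniform conjugated bound on `X_k` is the uniform entry decay of `avgTow A r X k` -/

/-- **`hdec` FROM CONJUGATED OPERATOR BOUNDS (the Combes–Thomas dictionary)**.  Let the averagings have indicator structure with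
`‖A_j‖² ≤ r⁻¹`, and let `ρ : ι 0 → ι k → ℝ` be centre-indexed weights with `ρ_y ≤ 0` on the block of `y` and `ρ_y ≥ dist(x,y) − c` on
the block of `x`.  If `‖conjMat κ (ρ y) (ρ y) (X k)‖ ≤ K` for every centre `y` (`κ ≥ 0`), then
`EntryDecay dist (avgTow A r X k) (K·e^{κc}) κ`. [folklore] -/
theorem entryDecay_avgTow_of_conjInv (hAi : ∀ k i u, A k i u = if prt k u = i then ((r : ℂ))⁻¹ else 0) (hr : 0 < r)
    (hA : ∀ k, ‖A k‖ ^ 2 ≤ r⁻¹) {X : (k : ℕ) → Matrix (ι k) (ι k) ℂ} {k : ℕ} {κ K c : ℝ} (hκ : 0 ≤ κ)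
    {dist : ι 0 → ι 0 → ℝ} (ρ : ι 0 → ι k → ℝ) (hK : ∀ y, ‖conjMat κ (ρ y) (ρ y) (X k)‖ ≤ K)
    (h0 : ∀ y u, prtk prt k u = y → ρ y u ≤ 0) (hR : ∀ x y u, prtk prt k u = x → dist x y - c ≤ ρ y u) :
    EntryDecay dist (avgTow A r X k) (K * Real.exp (κ * c)) κ := by
  intro x y
  rw [avgTow_apply_eq_pairing, norm_mul, norm_pow, Complex.norm_real, Real.norm_of_nonneg hr.le]
  have hu : ∀ u, star (Atow A k x) u ≠ 0 → dist x y - c ≤ ρ y u := fun u hu => hR x y u (star_Atow_apply_ne_zero hAi hu)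
  have hv : ∀ u, star (Atow A k y) u ≠ 0 → ρ y u ≤ 0 := fun u hu => h0 y u (star_Atow_apply_ne_zero hAi hu)
  have hp := pairing_le_of_opNorm_conjMat hκ (hK y) hu hv
  have hrk : 0 < r ^ k := pow_pos hr k
  have hn : ∀ z : ι 0, Real.sqrt (nsq (star (Atow A k z))) ≤ Real.sqrt ((r ^ k)⁻¹) :=
    fun z => Real.sqrt_le_sqrt (nsq_star_Atow_le A hr hA k z)
  have hK0 : 0 ≤ K := (norm_nonneg _).trans (hK y)
  have hss : Real.sqrt ((r ^ k)⁻¹) * Real.sqrt ((r ^ k)⁻¹) = (r ^ k)⁻¹ := Real.mul_self_sqrt (inv_nonneg.mpr hrk.le)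
  calc r ^ k * ‖star (star (Atow A k x)) ⬝ᵥ (X k *ᵥ star (Atow A k y))‖
      ≤ r ^ k * (K * Real.exp (-(κ * (dist x y - c))) * (Real.sqrt ((r ^ k)⁻¹) * Real.sqrt ((r ^ k)⁻¹))) := by
        refine mul_le_mul_of_nonneg_left (hp.trans ?_) hrk.le
        exact mul_le_mul_of_nonneg_left (mul_le_mul (hn x) (hn y) (Real.sqrt_nonneg _) (Real.sqrt_nonneg _)) (by positivity)
    _ = K * Real.exp (κ * c) * Real.exp (-(κ * dist x y)) := by
        rw [hss, show -(κ * (dist x y - c)) = κ * c + -(κ * dist x y) by ring, Real.exp_add]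
        field_simp

end Tower

/-! ## §4 The colour lift: weights read through `Prod.fst` -/

section Kron

variable {τ σ : Type*} [Fintype τ] [DecidableEq τ] [Fintype σ] [DecidableEq σ] {o : Type*} [Fintype o] [DecidableEq o]

omit [Fintype τ] [DecidableEq τ] [Fintype σ] [DecidableEq σ] [Fintype o] in
/-- **`conjMat` of a colour lift is the colour lift of `conjMat`** (weights ignore the colour). [folklore] -/
theorem conjMat_kron_one (κ : ℝ) (ρ : τ → ℝ) (ν : σ → ℝ) (X : Matrix τ σ ℂ) :
    conjMat κ (fun p : τ × o => ρ p.1) (fun q : σ × o => ν q.1) (X ⊗ₖ (1 : Matrix o o ℂ))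
      = conjMat κ ρ ν X ⊗ₖ (1 : Matrix o o ℂ) := by
  ext ⟨e, c⟩ ⟨e', c'⟩
  simp only [conjMat_apply, Matrix.kroneckerMap_apply]
  ring

variable {D : Matrix τ τ ℂ} {κ : ℝ} {ρ : τ → ℝ} {γw : ℝ}

/-- the lifted conjugated free operator is invertible. [folklore] -/
theorem isUnit_det_conjMat_kron_of_wCoercive (h : WCoercive D κ ρ γw) (hγ : 0 < γw) :
    IsUnit (conjMat κ (fun p : τ × o => ρ p.1) (fun p : τ × o => ρ p.1) (D ⊗ₖ (1 : Matrix o o ℂ))).det := by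
  rw [conjMat_kron_one]
  exact isUnit_det_kron o (isUnit_det_conjMat_of_wCoercive h hγ)

/-- **the lifted conjugated inverse**: `WCoercive D κ ρ γw ⟹ ‖conjMat ((D ⊗ₖ 1)⁻¹)‖ ≤ γw⁻¹` (weights through `Prod.fst`). [folklore] -/
theorem opNorm_conjMat_kron_inv_le_of_wCoercive (h : WCoercive D κ ρ γw) (hγ : 0 < γw) :
    ‖conjMat κ (fun p : τ × o => ρ p.1) (fun p : τ × o => ρ p.1) (D ⊗ₖ (1 : Matrix o o ℂ))⁻¹‖ ≤ γw⁻¹ := by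
  rw [kron_inv, conjMat_kron_one]
  exact (opNorm_kron_le o _).trans (opNorm_conjMat_inv_le_of_wCoercive h hγ)

/-- **the lifted conjugated perturbed inverse**: `WCoercive D κ ρ γw` (un-lifted), a conjugated relative bound
`‖conjMat P · conjMat ((D ⊗ₖ 1)⁻¹)‖ ≤ κ′` for the colour perturbation `P`, and `‖t‖κ′ < 1` ⟹
`‖conjMat ((D ⊗ₖ 1 + t•P)⁻¹)‖ ≤ γw⁻¹·(1 − ‖t‖κ′)⁻¹`. [folklore] -/
theorem opNorm_conjMat_kron_pertInv_le_of_wCoercive (h : WCoercive D κ ρ γw) (hγ : 0 < γw) {P : Matrix (τ × o) (τ × o) ℂ}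
    {κ' : ℝ} (hP : ‖conjMat κ (fun p : τ × o => ρ p.1) (fun p : τ × o => ρ p.1) P
      * conjMat κ (fun p : τ × o => ρ p.1) (fun p : τ × o => ρ p.1) (D ⊗ₖ (1 : Matrix o o ℂ))⁻¹‖ ≤ κ')
    {t : ℂ} (ht : ‖t‖ * κ' < 1) :
    ‖conjMat κ (fun p : τ × o => ρ p.1) (fun p : τ × o => ρ p.1) (D ⊗ₖ (1 : Matrix o o ℂ) + t • P)⁻¹‖
      ≤ γw⁻¹ * (1 - ‖t‖ * κ')⁻¹ :=
  opNorm_conjMat_inv_add_smul_le (isUnit_det_conjMat_kron_of_wCoercive h hγ) (opNorm_conjMat_kron_inv_le_of_wCoercive h hγ) hP ht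

end Kron

end Summit.QuantumFields.BalabanUV.T4Continuum.CTAveragedTowerDecay

end
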